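import Summits.QuantumFields.YangMills.Theorems.BalabanUVNodesN15TwoGridDefectLap
import HarnessLib

/-!
# Route «BalabanUVNodes», node N15 = NE2, -a lane, part 44: DOOR (iv) — THE OUTPUT SWAP `(P̂₂ − P)∘G` OF THE TWO-GRID SPLIT `G′P − PG = 𝔇 + (P̂₂ − P)G` IS
# `O(η)` AS A BLOCK MAJORANT (`C·(L^k)⁻¹·e^{−δ₀|y−y′|_T}`), HYPOTHESIS-FREE ON THE TORUS FAMILY OF RECORD

Cell `pub-ymgap`, seat `pub-ymgap-dag-n15-a` (KNIT-BY-NAME, g11); `--supports stmt-QuantumFields-20290 --as helper`; `HOME/pub-ymgap-dag-n15-a/DOOR-IV-PLAN.md` §7.1(i)∕§7.2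
(route R, split (A): `G′P − PG = idef P P̂₂ G′ G + (P̂₂ − P)G`, `idef P P̂₂ G′ G = −G′(Δ′_aP̂₂ − PΔ_a)G`).  Over parts 34 (`symbOp`, `sA`, `sSm`, `symbOp_sT_pow_apply`),
35 (`kingPr_add_smul_unitVec_of_le`), 40 (`hasMaj_finsum`, `hasMaj_smul_ofBlocks`, `hasMaj_one_add_sA_comp`, `hasMaj_prod_sA_sq_comp`), 42 (`hasMaj_grad_of_ineq`,
`ineq110_114_pair`), 43 (imports) and n15-c's carrier (`blkFine`, `kingPrV`, `blkFine_comp_kingPrV`).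
THE ESTIMATE.  `P̂₂ − P = ρ′(Π_νa_ν(R)² − 1)∘P`, `R = L^m`, and (§32, `Finset.prod_one_sub_ordered`) `Π_νa_ν² − 1 = Σ_ν (Π_{ν′<ν}a_{ν′}²)(1 + a_ν)·R⁻¹Σ_{j<R}(s_ν^j − 1)`;
each `(ρ′(s_ν^j)∘P − P)u` at a fine bond `(x′, κ)` is `u(kingPr x′ + εe_ν, κ) − u(kingPr x′, κ)`, `ε ∈ {0,1}` (`j ≤ R`), i.e. `0` or `η·(∇_νu)(kingPr x′, κ)` over the SAME
unit block (§33 `hasMaj_shiftPull_sub`); with `u = Gμ` the (1.110) entry «∇GJ» of the coarse member gives the majorant `η·C₀e^{−δ₀d}`, the average over `j` keeps it, and the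
symbol prefactors cost `2e^{δ₀}·e^{2|{ν′<ν}|δ₀} ≤ 2e^{(2d+1)δ₀}` (part 40): ★★ **`hasMaj_outputSwap`**: `∃ δ C > 0 ∀ m_T k ≥ 1 m`,
`HasMaj (ofBlocks … blkFine) (ofBlocks … blockOf_{L^m·L^k}) ((ρ′(sSm)∘P − P)∘G) (C·(L^k)⁻¹·e^{−δ tdistT})`, with the explicit-constant core `hasMaj_outputSwap_core`.
CONTENTS.  §32 `sA_sub_one`, `sSm_sub_one`; §33 `hasMaj_shiftPull_sub`; §34 `hasMaj_outputSwap_core`, `hasMaj_outputSwap`.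
HONEST FRAMING ∕ LIMITS.  One more term of door (iv) entry 0 (after part 43's two Laplacian terms): still NOT the averaging term `a·C_Q` (part 37 inputs) and NOT the Landau
term `C_V` (plan §7.4(a), not in printed currency), nor the `idef` bookkeeping; constants crude and ours; Bałaban's inequality enters only through the tree's theorem
`prop12_famG_printed`; tori of record; `U ≡ 1`; count-neutral (typed 28∕28 · discharged 5∕28 unchanged); NOT a discharge of N15 (object-bound; NE2⁺ NOT PRINTED); one finite
T⁴ at fixed ε — NOT infinite volume, NOT OS on ℝ⁴, NOT a mass gap, NOT Clay.
-/

noncomputable section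

open scoped BigOperators Matrix
open Finset

namespace Summit.QuantumFields.YangMills.BalabanUVNodes.N15.TwoGrid

open Literature.MathematicalPhysics.QuantumFieldTheory.Balaban1983to89
open Literature.MathematicalPhysics.QuantumFieldTheory.Balaban1983to89.B11SectG (BlockNorm HasMaj)
open Literature.MathematicalPhysics.QuantumFieldTheory.Balaban1983to89.B11AxialTransport190 (abs_le_loc_ofBlocks loc_ofBlocks_le)
open Literature.MathematicalPhysics.QuantumFieldTheory.Balaban1983to89.T4EtaRateCoeffDefect (pull pull_apply)
open Literature.MathematicalPhysics.QuantumFieldTheory.Balaban1983to89.B5Prop11Plancherel (Tor fine unitVec)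
open Literature.MathematicalPhysics.QuantumFieldTheory.Balaban1983to89.B5SettingP12Real (latticeSettingP12R)
open Literature.MathematicalPhysics.QuantumFieldTheory.Balaban1983to89.B5SiteBridgeP12 (MP)
open Literature.MathematicalPhysics.QuantumFieldTheory.King1986.Torus (blockOf tdistT tdistT_nonneg)
open Literature.MathematicalPhysics.QuantumFieldTheory.Balaban1983to89.B6UnitTorusCarrier (unitTorusGeo)
open Summit.QuantumFields.YangMills.BalabanUVNodes.N15.VectorPiece (blkFine blkFine_apply kingPr kingPrV kingPrV_eq blkFine_comp_kingPrV)

variable {d : ℕ}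

/-! ## §32 The symbol of the smoothing defect: `Π_νa_ν² − 1 = Σ_ν (Π_{ν′<ν}a_{ν′}²)(1 + a_ν)·R⁻¹Σ_{j<R}(s_ν^j − 1)` -/

section Symbols

variable (M : Fin (d + 1) → ℕ) (n : ℕ)

/-- `a_κ(R) − 1 = R⁻¹Σ_{j<R}(s_κ^j − 1)` (`R ≠ 0`). [folklore] -/
theorem sA_sub_one (κ : Fin (d + 1)) {R : ℕ} (hR : R ≠ 0) :
    sA M n κ R - 1 = (R : ℝ)⁻¹ • ∑ j ∈ range R, (sT M n κ ^ j - 1) := by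
  have hR' : (R : ℝ) ≠ 0 := Nat.cast_ne_zero.mpr hR
  rw [sum_sub_distrib, smul_sub, sum_const, card_range, ← Nat.cast_smul_eq_nsmul ℝ, smul_smul, inv_mul_cancel₀ hR', one_smul, sA]

/-- **THE SMOOTHING DEFECT SYMBOL, TELESCOPED**: `Π_νa_ν(R)² − 1 = Σ_ν (Π_{ν′<ν}a_{ν′}²)·(1 + a_ν)·(R⁻¹Σ_{j<R}(s_ν^j − 1))` (`Finset.prod_one_sub_ordered`). [folklore] -/
theorem sSm_sub_one {R : ℕ} (hR : R ≠ 0) :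
    sSm M n R - 1 = ∑ ν : Fin (d + 1), (∏ ν' ∈ univ.filter (fun ν' => ν' < ν), sA M n ν' R ^ 2) * (1 + sA M n ν R) *
      ((R : ℝ)⁻¹ • ∑ j ∈ range R, (sT M n ν ^ j - 1)) := by
  classical
  have htel := prod_one_sub_ordered (univ : Finset (Fin (d + 1))) fun ν => 1 - sA M n ν R ^ 2
  simp only [sub_sub_cancel] at htel
  rw [sSm, htel, sub_sub_cancel_left, ← sum_neg_distrib]
  refine sum_congr rfl fun ν _ => ?_
  rw [← sA_sub_one M n ν hR]
  ring

end Symbols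

/-! ## §33 Shifting a prolongation by `j ≤ L^m` fine steps costs one coarse difference, in block-majorant currency -/

section ShiftPull

variable {L : ℕ} [NeZero L] (M : Fin (d + 1) → ℕ) [∀ μ, NeZero (M μ)] (k m : ℕ) {F₁ : Type} [AddCommGroup F₁] [Module ℝ F₁]

/-- **`(τ′_{je′_ν} − 1)P` IS DOMINATED BY `η·∇_ν` BLOCKWISE**: if `η∇_νS = (n⁻¹ρ(n(s_ν−1)))∘S` (`n = L^k`) has a majorant `K ≥ 0` into coarse 1-forms blocked by King's unit
blocks, then `(ρ′(s_ν^j)∘P − P)∘S`, `j ≤ L^m`, has the same majorant into fine 1-forms — `kingPr(x′ + je′_ν) ∈ {kingPr x′, kingPr x′ + e_ν}` (part 35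
`kingPr_add_smul_unitVec_of_le`) and both lie over the same unit block. [cite: King1986, p.664 (pairing convention); Balaban1984PropagatorsI, (1.31) p.23] -/
theorem hasMaj_shiftPull_sub {b₁ : BlockNorm (unitTorusGeo L k M) F₁} {S : F₁ →ₗ[ℝ] (Tor (fine (L ^ k) M) × Fin (d + 1) → ℝ)}
    {K : Tor M → Tor M → ℝ} (hK : ∀ y y', 0 ≤ K y y') (ν : Fin (d + 1)) {j : ℕ} (hj : j ≤ L ^ m)
    (h : HasMaj b₁ (BlockNorm.ofBlocks (unitTorusGeo L k M) (blkFine L k M)) ((((L ^ k : ℕ) : ℝ)⁻¹ • symbOp M (L ^ k) (sD M (L ^ k) ν ((L ^ k : ℕ) : ℝ))) ∘ₗ S) K) :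
    HasMaj b₁ (BlockNorm.ofBlocks (unitTorusGeo L k M) (fun i : Tor (fine (L ^ m * L ^ k) M) × Fin (d + 1) => blockOf (L ^ m * L ^ k) M i.1))
      ((symbOp M (L ^ m * L ^ k) (sT M (L ^ m * L ^ k) ν ^ j) ∘ₗ pull (kingPrV L k m M) - pull (kingPrV L k m M)) ∘ₗ S) K := by
  have hn0 : (0 : ℝ) < ((L ^ k : ℕ) : ℝ) := by exact_mod_cast Nat.one_le_pow _ _ (Nat.pos_of_ne_zero (NeZero.ne L))
  intro y' μ hμ y
  refine loc_ofBlocks_le (g := unitTorusGeo L k M) (fun i : Tor (fine (L ^ m * L ^ k) M) × Fin (d + 1) => blockOf (L ^ m * L ^ k) M i.1) _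
    (mul_nonneg (hK y y') (b₁.loc_nonneg y' μ)) fun x' hx' => ?_
  obtain ⟨x, κ⟩ := x'
  rw [LinearMap.comp_apply, LinearMap.sub_apply, LinearMap.comp_apply, Pi.sub_apply, symbOp_sT_pow_apply, pull_apply, pull_apply, kingPrV_eq, kingPrV_eq]
  obtain ⟨δ, hδ, e⟩ := kingPr_add_smul_unitVec_of_le M L k m x ν hj
  simp only at e ⊢
  rw [e]
  have hblk : blockOf (L ^ k) M (kingPr L k m M x) = y := by
    have hx := congrFun (blkFine_comp_kingPrV M L k m) (x, κ)
    simp only [Function.comp, blkFine_apply, kingPrV_eq] at hx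
    rw [hx]; exact hx'
  interval_cases δ
  · rw [zero_smul, add_zero, sub_self, abs_zero]
    exact mul_nonneg (hK y y') (b₁.loc_nonneg y' μ)
  · rw [one_smul]
    have hval : S μ (kingPr L k m M x + unitVec (fine (L ^ k) M) ν, κ) - S μ (kingPr L k m M x, κ)
        = ((((L ^ k : ℕ) : ℝ)⁻¹ • symbOp M (L ^ k) (sD M (L ^ k) ν ((L ^ k : ℕ) : ℝ))) ∘ₗ S) μ (kingPr L k m M x, κ) := by
      rw [LinearMap.comp_apply, LinearMap.smul_apply, Pi.smul_apply, symbOp_sD_apply, smul_eq_mul, ← mul_assoc, inv_mul_cancel₀ hn0.ne', one_mul]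
    rw [hval]
    calc |((((L ^ k : ℕ) : ℝ)⁻¹ • symbOp M (L ^ k) (sD M (L ^ k) ν ((L ^ k : ℕ) : ℝ))) ∘ₗ S) μ (kingPr L k m M x, κ)|
        ≤ (BlockNorm.ofBlocks (unitTorusGeo L k M) (blkFine L k M)).loc (blkFine L k M (kingPr L k m M x, κ))
            (((((L ^ k : ℕ) : ℝ)⁻¹ • symbOp M (L ^ k) (sD M (L ^ k) ν ((L ^ k : ℕ) : ℝ))) ∘ₗ S) μ) :=
          abs_le_loc_ofBlocks (g := unitTorusGeo L k M) (blkFine L k M) _ rfl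
      _ ≤ K (blkFine L k M (kingPr L k m M x, κ)) y' * b₁.loc y' μ := h y' μ hμ _
      _ = K y y' * b₁.loc y' μ := by rw [blkFine_apply]; simp only; rw [hblk]

end ShiftPull

/-! ## §34 ★★ THE OUTPUT SWAP `(P̂₂ − P)∘G` IS `O(η)` IN BLOCK-MAJORANT CURRENCY -/

section OutputSwap

variable {L : ℕ} [NeZero L] (M : Fin (d + 1) → ℕ) [∀ μ, NeZero (M μ)] (k m : ℕ) (a : ℝ)

/-- **CORE ESTIMATE (explicit constants)** behind `hasMaj_outputSwap`: for ONE torus `M`, given the (1.110)–(1.114) package of the coarse member,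
`(ρ′(Π_νa_ν²)∘P − P)∘G` has the block majorant `(d+1)·2C₀e^{(2d+1)δ₀}·(L^k)⁻¹·e^{−δ₀|y−y′|_T}`. [cite: Balaban1984PropagatorsI, Prop. 1.2 (1.110) p.35] -/
theorem hasMaj_outputSwap_core {C₀ δ₀ : ℝ} {Cα Cε : ℝ → ℝ} {Cαε : ℝ → ℝ → ℝ} (hC₀ : 0 < C₀) (hδ₀ : 0 < δ₀)
    (HP1 : B5.Ineq110_114 (latticeSettingP12R (L ^ k) M a k) C₀ Cα Cε Cαε δ₀) :
    HasMaj (BlockNorm.ofBlocks (unitTorusGeo L k M) (blkFine L k M)) (BlockNorm.ofBlocks (unitTorusGeo L k M) (fun i : Tor (fine (L ^ m * L ^ k) M) × Fin (d + 1) => blockOf (L ^ m * L ^ k) M i.1))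
      ((symbOp M (L ^ m * L ^ k) (sSm M (L ^ m * L ^ k) (L ^ m)) ∘ₗ (pull (kingPrV L k m M)) - (pull (kingPrV L k m M))) ∘ₗ gOp M (L ^ k) a)
      (fun y y' => (((d : ℝ) + 1) * (2 * C₀ * Real.exp δ₀ ^ (2 * d + 1))) * ((L ^ k : ℕ) : ℝ)⁻¹ * Real.exp (-(δ₀ * tdistT M y y'))) := by
  classical
  have hL0 : 0 < L := Nat.pos_of_ne_zero (NeZero.ne L)
  have hn1 : 1 ≤ L ^ k := Nat.one_le_pow _ _ hL0
  have hR0 : L ^ m ≠ 0 := by positivity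
  have hn'1 : 1 ≤ L ^ m * L ^ k := Nat.one_le_iff_ne_zero.mpr (Nat.mul_ne_zero hR0 (by positivity))
  have hn0 : (0 : ℝ) < ((L ^ k : ℕ) : ℝ) := by exact_mod_cast hn1
  have hRn' : L ^ m ≤ L ^ m * L ^ k := Nat.le_mul_of_pos_right _ hn1
  have hR' : (0 : ℝ) < ((L ^ m : ℕ) : ℝ) := by exact_mod_cast Nat.pos_of_ne_zero hR0
  -- (1) `η∇_νG` has majorant `η·C₀e^{−δ₀d}` (entry «∇GJ», coarse member)
  have hgrad : ∀ ν : Fin (d + 1), HasMaj (BlockNorm.ofBlocks (unitTorusGeo L k M) (blkFine L k M)) (BlockNorm.ofBlocks (unitTorusGeo L k M) (blkFine L k M)) ((((L ^ k : ℕ) : ℝ)⁻¹ • symbOp M (L ^ k) (sD M (L ^ k) ν ((L ^ k : ℕ) : ℝ))) ∘ₗ gOp M (L ^ k) a)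
      (fun y y' => ((L ^ k : ℕ) : ℝ)⁻¹ * C₀ * Real.exp (-(δ₀ * tdistT M y y'))) := by
    intro ν
    have h1 := hasMaj_grad_of_ineq (L := L) M k (L ^ k) a hn1 HP1 hC₀.le ν
    rw [LinearMap.smul_comp]
    refine (hasMaj_smul_ofBlocks (g := (unitTorusGeo L k M)) (blkFine L k M) (fun y y' => mul_nonneg hC₀.le (Real.exp_nonneg _)) (((L ^ k : ℕ) : ℝ)⁻¹) h1).mono
      fun y y' => le_of_eq ?_
    rw [abs_of_nonneg (inv_nonneg.mpr hn0.le), mul_assoc]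
  -- (2) each `(ρ′(s_ν^j)∘P − P)∘G`, `j < L^m`; their average; the symbol prefactors `ρ′(1 + a_ν)`, `ρ′(Π_{ν′<ν}a²)`
  have hterm : ∀ ν : Fin (d + 1), HasMaj (BlockNorm.ofBlocks (unitTorusGeo L k M) (blkFine L k M)) (BlockNorm.ofBlocks (unitTorusGeo L k M) (fun i : Tor (fine (L ^ m * L ^ k) M) × Fin (d + 1) => blockOf (L ^ m * L ^ k) M i.1))
      (symbOp M (L ^ m * L ^ k) (∏ ν' ∈ univ.filter (fun ν' => ν' < ν), sA M (L ^ m * L ^ k) ν' (L ^ m) ^ 2) ∘ₗ (symbOp M (L ^ m * L ^ k) (1 + sA M (L ^ m * L ^ k) ν (L ^ m)) ∘ₗ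
        ((((L ^ m : ℕ) : ℝ)⁻¹ • ∑ j ∈ range (L ^ m), (symbOp M (L ^ m * L ^ k) (sT M (L ^ m * L ^ k) ν ^ j) ∘ₗ (pull (kingPrV L k m M)) - (pull (kingPrV L k m M)))) ∘ₗ gOp M (L ^ k) a)))
      (fun y y' => 2 * (((L ^ k : ℕ) : ℝ)⁻¹ * C₀) * Real.exp δ₀ * Real.exp δ₀ ^ (2 * (univ.filter (fun ν' => ν' < ν)).card) * Real.exp (-(δ₀ * tdistT M y y'))) := by
    intro ν
    have hK0 : ∀ y y' : Tor M, 0 ≤ ((L ^ k : ℕ) : ℝ)⁻¹ * C₀ * Real.exp (-(δ₀ * tdistT M y y')) := fun y y' =>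
      mul_nonneg (mul_nonneg (inv_nonneg.mpr hn0.le) hC₀.le) (Real.exp_nonneg _)
    have hJ : ∀ j ∈ range (L ^ m), HasMaj (BlockNorm.ofBlocks (unitTorusGeo L k M) (blkFine L k M)) (BlockNorm.ofBlocks (unitTorusGeo L k M) (fun i : Tor (fine (L ^ m * L ^ k) M) × Fin (d + 1) => blockOf (L ^ m * L ^ k) M i.1)) ((symbOp M (L ^ m * L ^ k) (sT M (L ^ m * L ^ k) ν ^ j) ∘ₗ (pull (kingPrV L k m M)) - (pull (kingPrV L k m M))) ∘ₗ gOp M (L ^ k) a)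
        (fun y y' => ((L ^ k : ℕ) : ℝ)⁻¹ * C₀ * Real.exp (-(δ₀ * tdistT M y y'))) :=
      fun j hj => hasMaj_shiftPull_sub M k m hK0 ν (mem_range.mp hj).le (hgrad ν)
    have hsumJ := hasMaj_finsum (g := (unitTorusGeo L k M)) (b₁ := (BlockNorm.ofBlocks (unitTorusGeo L k M) (blkFine L k M))) (b₂ := (BlockNorm.ofBlocks (unitTorusGeo L k M) (fun i : Tor (fine (L ^ m * L ^ k) M) × Fin (d + 1) => blockOf (L ^ m * L ^ k) M i.1))) (range (L ^ m))
      (fun j => (symbOp M (L ^ m * L ^ k) (sT M (L ^ m * L ^ k) ν ^ j) ∘ₗ (pull (kingPrV L k m M)) - (pull (kingPrV L k m M))) ∘ₗ gOp M (L ^ k) a)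
      (fun _ y y' => ((L ^ k : ℕ) : ℝ)⁻¹ * C₀ * Real.exp (-(δ₀ * tdistT M y y'))) hJ
    have havg : HasMaj (BlockNorm.ofBlocks (unitTorusGeo L k M) (blkFine L k M)) (BlockNorm.ofBlocks (unitTorusGeo L k M) (fun i : Tor (fine (L ^ m * L ^ k) M) × Fin (d + 1) => blockOf (L ^ m * L ^ k) M i.1)) ((((L ^ m : ℕ) : ℝ)⁻¹ • ∑ j ∈ range (L ^ m), (symbOp M (L ^ m * L ^ k) (sT M (L ^ m * L ^ k) ν ^ j) ∘ₗ (pull (kingPrV L k m M)) - (pull (kingPrV L k m M)))) ∘ₗ gOp M (L ^ k) a)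
        (fun y y' => ((L ^ k : ℕ) : ℝ)⁻¹ * C₀ * Real.exp (-(δ₀ * tdistT M y y'))) := by
      refine ((hasMaj_smul_ofBlocks (g := (unitTorusGeo L k M)) (fun i : Tor (fine (L ^ m * L ^ k) M) × Fin (d + 1) => blockOf (L ^ m * L ^ k) M i.1)
        (fun y y' => sum_nonneg fun _ _ => hK0 y y') (((L ^ m : ℕ) : ℝ)⁻¹) hsumJ).congr fun μ => ?_).mono fun y y' => le_of_eq ?_
      · simp only [LinearMap.smul_apply, LinearMap.sum_apply, LinearMap.comp_apply, LinearMap.smul_comp]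
      · rw [sum_const, card_range, nsmul_eq_mul, abs_of_nonneg (inv_nonneg.mpr hR'.le), ← mul_assoc, inv_mul_cancel₀ hR'.ne', one_mul]
    have hB0 : 0 ≤ ((L ^ k : ℕ) : ℝ)⁻¹ * C₀ := mul_nonneg (inv_nonneg.mpr hn0.le) hC₀.le
    have h1a := hasMaj_one_add_sA_comp M k (L ^ m * L ^ k) hB0 hδ₀.le ν hR0 hRn' havg
    have hB1 : 0 ≤ 2 * (((L ^ k : ℕ) : ℝ)⁻¹ * C₀) * Real.exp δ₀ := mul_nonneg (mul_nonneg zero_le_two hB0) (Real.exp_nonneg _)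
    exact hasMaj_prod_sA_sq_comp M k (L ^ m * L ^ k) hB1 hδ₀.le hR0 hRn' (univ.filter (fun ν' => ν' < ν)) h1a
  -- (3) uniform kernel per direction, the sum over directions, and the operator identity
  have hcard : ∀ ν : Fin (d + 1), (univ.filter (fun ν' => ν' < ν)).card ≤ d := fun ν => by
    have hlt : (univ.filter (fun ν' => ν' < ν)).card < (univ : Finset (Fin (d + 1))).card :=
      card_lt_card ⟨filter_subset _ _, fun hsub => by simpa using hsub (mem_univ ν)⟩
    rw [card_univ, Fintype.card_fin] at hlt
    omega
  have hterm' : ∀ ν : Fin (d + 1), HasMaj (BlockNorm.ofBlocks (unitTorusGeo L k M) (blkFine L k M)) (BlockNorm.ofBlocks (unitTorusGeo L k M) (fun i : Tor (fine (L ^ m * L ^ k) M) × Fin (d + 1) => blockOf (L ^ m * L ^ k) M i.1))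
      (symbOp M (L ^ m * L ^ k) (∏ ν' ∈ univ.filter (fun ν' => ν' < ν), sA M (L ^ m * L ^ k) ν' (L ^ m) ^ 2) ∘ₗ (symbOp M (L ^ m * L ^ k) (1 + sA M (L ^ m * L ^ k) ν (L ^ m)) ∘ₗ
        ((((L ^ m : ℕ) : ℝ)⁻¹ • ∑ j ∈ range (L ^ m), (symbOp M (L ^ m * L ^ k) (sT M (L ^ m * L ^ k) ν ^ j) ∘ₗ (pull (kingPrV L k m M)) - (pull (kingPrV L k m M)))) ∘ₗ gOp M (L ^ k) a)))
      (fun y y' => 2 * (((L ^ k : ℕ) : ℝ)⁻¹ * C₀) * Real.exp δ₀ ^ (2 * d + 1) * Real.exp (-(δ₀ * tdistT M y y'))) := fun ν =>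
    (hterm ν).mono fun y y' => by
      have he1 : 1 ≤ Real.exp δ₀ := Real.one_le_exp hδ₀.le
      have hpow : Real.exp δ₀ * Real.exp δ₀ ^ (2 * (univ.filter (fun ν' => ν' < ν)).card) ≤ Real.exp δ₀ ^ (2 * d + 1) := by
        rw [← pow_succ']
        exact pow_le_pow_right₀ he1 (by have := hcard ν; omega)
      have hB0 : 0 ≤ 2 * (((L ^ k : ℕ) : ℝ)⁻¹ * C₀) := mul_nonneg zero_le_two (mul_nonneg (inv_nonneg.mpr hn0.le) hC₀.le)
      calc 2 * (((L ^ k : ℕ) : ℝ)⁻¹ * C₀) * Real.exp δ₀ * Real.exp δ₀ ^ (2 * (univ.filter (fun ν' => ν' < ν)).card) * Real.exp (-(δ₀ * tdistT M y y'))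
          = 2 * (((L ^ k : ℕ) : ℝ)⁻¹ * C₀) * (Real.exp δ₀ * Real.exp δ₀ ^ (2 * (univ.filter (fun ν' => ν' < ν)).card)) * Real.exp (-(δ₀ * tdistT M y y')) := by ring
        _ ≤ 2 * (((L ^ k : ℕ) : ℝ)⁻¹ * C₀) * Real.exp δ₀ ^ (2 * d + 1) * Real.exp (-(δ₀ * tdistT M y y')) :=
            mul_le_mul_of_nonneg_right (mul_le_mul_of_nonneg_left hpow hB0) (Real.exp_nonneg _)
  have hsum := hasMaj_finsum (g := (unitTorusGeo L k M)) (b₁ := (BlockNorm.ofBlocks (unitTorusGeo L k M) (blkFine L k M))) (b₂ := (BlockNorm.ofBlocks (unitTorusGeo L k M) (fun i : Tor (fine (L ^ m * L ^ k) M) × Fin (d + 1) => blockOf (L ^ m * L ^ k) M i.1))) Finset.univ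
    (fun ν => symbOp M (L ^ m * L ^ k) (∏ ν' ∈ univ.filter (fun ν' => ν' < ν), sA M (L ^ m * L ^ k) ν' (L ^ m) ^ 2) ∘ₗ (symbOp M (L ^ m * L ^ k) (1 + sA M (L ^ m * L ^ k) ν (L ^ m)) ∘ₗ
        ((((L ^ m : ℕ) : ℝ)⁻¹ • ∑ j ∈ range (L ^ m), (symbOp M (L ^ m * L ^ k) (sT M (L ^ m * L ^ k) ν ^ j) ∘ₗ (pull (kingPrV L k m M)) - (pull (kingPrV L k m M)))) ∘ₗ gOp M (L ^ k) a)))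
    (fun _ y y' => 2 * (((L ^ k : ℕ) : ℝ)⁻¹ * C₀) * Real.exp δ₀ ^ (2 * d + 1) * Real.exp (-(δ₀ * tdistT M y y'))) fun ν _ => hterm' ν
  have hsym := sSm_sub_one M (L ^ m * L ^ k) (R := (L ^ m)) hR0
  refine (hsum.congr fun μ => ?_).mono fun y y' => ?_
  · -- `Σ_ν ρ′(Π)ρ′(1+a)·(R⁻¹Σ_j(ρ′(s^j)P − P))(Gμ) = (ρ′(sSm)P − P)(Gμ)`
    have hR : symbOp M (L ^ m * L ^ k) (sSm M (L ^ m * L ^ k) (L ^ m)) ((pull (kingPrV L k m M)) (gOp M (L ^ k) a μ)) - (pull (kingPrV L k m M)) (gOp M (L ^ k) a μ)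
        = symbOp M (L ^ m * L ^ k) (sSm M (L ^ m * L ^ k) (L ^ m) - 1) ((pull (kingPrV L k m M)) (gOp M (L ^ k) a μ)) := by
      rw [map_sub, map_one, LinearMap.sub_apply, Module.End.one_apply]
    simp only [LinearMap.sum_apply, LinearMap.comp_apply, LinearMap.sub_apply]
    rw [hR, hsym, map_sum, LinearMap.sum_apply]
    refine Finset.sum_congr rfl fun ν _ => ?_
    simp only [map_mul, map_add, map_one, map_smul, map_sum, map_sub, map_pow, Module.End.mul_apply, LinearMap.smul_apply, LinearMap.sum_apply,
      LinearMap.sub_apply, LinearMap.comp_apply, Module.End.one_apply, LinearMap.add_apply]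
  · have hE := Real.exp_nonneg (-(δ₀ * tdistT M y y'))
    rw [sum_const, card_univ, Fintype.card_fin, nsmul_eq_mul, Nat.cast_succ]
    exact le_of_eq (by ring)

/-- ★★ **`(P̂₂ − P)∘G` HAS THE BLOCK MAJORANT `C·(L^k)⁻¹·e^{−δ₀|y−y′|_T}`, HYPOTHESIS-FREE** — the output-side swap of the split `G′P − PG = idef P P̂₂ G′ G + (P̂₂ − P)G`
(plan §7.2, split (A)): `P̂₂ − P = ρ′(Π_νa_ν² − 1)∘P = Σ_ν ρ′(Π_{ν′<ν}a²)ρ′(1 + a_ν)·L^{−m}Σ_{j<L^m}(ρ′(s_ν^j)P − P)` (§32) and each `(ρ′(s_ν^j)P − P)G` is dominated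
blockwise by `η∇_νG` (§33), whose majorant is `η·C₀e^{−δ₀d}` by (1.110) entry «∇GJ» (part 42 `hasMaj_grad_of_ineq`, coarse member of `ineq110_114_pair`); the symbol
prefactors cost `2e^{δ₀}·e^{2dδ₀}` (part 40). [cite: Balaban1984PropagatorsI, Prop. 1.2 (1.110) p.35; King1986, Prop. 3.9 p.664 (η-rate shape)] -/
theorem hasMaj_outputSwap (hL : Odd L ∧ 1 < L) {a : ℝ} (ha : 0 < a) :
    ∃ δ C : ℝ, 0 < δ ∧ 0 < C ∧ ∀ (mT k m : ℕ) (hk : 1 ≤ k),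
      HasMaj (BlockNorm.ofBlocks (unitTorusGeo L k (MP (paramsOf d L mT k hL))) (blkFine L k (MP (paramsOf d L mT k hL))))
        (BlockNorm.ofBlocks (unitTorusGeo L k (MP (paramsOf d L mT k hL)))
          (fun i : Tor (fine (L ^ m * L ^ k) (MP (paramsOf d L mT k hL))) × Fin (d + 1) => blockOf (L ^ m * L ^ k) (MP (paramsOf d L mT k hL)) i.1))
        ((symbOp (MP (paramsOf d L mT k hL)) (L ^ m * L ^ k) (sSm (MP (paramsOf d L mT k hL)) (L ^ m * L ^ k) (L ^ m)) ∘ₗ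
            pull (kingPrV L k m (MP (paramsOf d L mT k hL))) - pull (kingPrV L k m (MP (paramsOf d L mT k hL)))) ∘ₗ
          gOp (MP (paramsOf d L mT k hL)) (L ^ k) a)
        (fun y y' => C * ((L ^ k : ℕ) : ℝ)⁻¹ * Real.exp (-(δ * tdistT (MP (paramsOf d L mT k hL)) y y'))) := by
  obtain ⟨δ₀, C₀, Cα, Cε, Cαε, hδ₀, hC₀, HP⟩ := ineq110_114_pair (d := d) hL ha
  refine ⟨δ₀, ((d : ℝ) + 1) * (2 * C₀ * Real.exp δ₀ ^ (2 * d + 1)) + 1, hδ₀, by positivity, fun mT k m hk => ?_⟩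
  refine (hasMaj_outputSwap_core (MP (paramsOf d L mT k hL)) k m a hC₀ hδ₀ (HP mT k m hk).1).mono fun y y' => ?_
  have hn0 : (0 : ℝ) < ((L ^ k : ℕ) : ℝ) := by exact_mod_cast Nat.one_le_pow _ _ (Nat.pos_of_ne_zero (NeZero.ne L))
  exact mul_le_mul_of_nonneg_right (mul_le_mul_of_nonneg_right (by linarith) (inv_nonneg.mpr hn0.le)) (Real.exp_nonneg _)

end OutputSwap

end Summit.QuantumFields.YangMills.BalabanUVNodes.N15.TwoGrid
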